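import Mathlib
import HarnessLib
import HarnessLib.Audit
import Summits.NavierStokesRegularity.Statement
import Literature.Analysis.FluidPDE.ClassicalSolution
import Literature.Analysis.FluidPDE.LerayHopf
import Literature.Analysis.FluidPDE.VectorCalculus
import Literature.Analysis.FluidPDE.NSWave0

/-!
Route: HodographBetchov

DORMANT since 2026-09-03T05:49:12Z (reconciler: no traction for 5 d (last activity statement-checked at 2026-08-29T04:58:43Z); parked, not closed — `ledger route dormant route-NavierStokesRegularity-HodographBetchov --off` to reactivate) — unstaffed, not closed; items shared with open routes are served there. `ledger route dormant <id> --off` reactivates.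

# Route HodographBetchov — Betchov on velocity classes — hodograph degree localises stretching to
fast fluid; slow collar plus fast squeeze

X = SlowClassProduction ∧ FastClassSqueeze ("it suffices to show"; realises card
hodograph-degree-conditional-betchov-v2,
critic-graded new-mechanism 2026-08-16, unrouted). OBJECT: the velocity classes F_l(t) = {x :
|u(x,t)| > l} (fast) and
{|u| ≤ l} (slow) of a classical Leray–Hopf solution, and the HODOGRAPH IDENTITY behind them: u(·,t)
: ℝ³ → ℝ³ is a decaying
C¹ map of Brouwer degree zero, so the signed Jacobian measure pushes forward to ZERO, u_#(det∇u dx)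
≡ 0, i.e.
∫ g(u) det∇u dx = 0 for every bounded Borel g; with tr∇u = 0 (det∇u = det S + ¼ ω·Sω) this is
BETCHOV ON EVERY VELOCITY
CLASS: ∫ g(u) ω·Sω = −4 ∫ g(u) det S = 4 ∫ g(u) λ₂|λ₁||λ₃| — enstrophy production restricted to any
velocity class is slaved
to strain SHAPE (sign of the middle eigenvalue), alignment-free and collar-free. SlowClassProduction
(crux 2): the production
of the slow class {|u| ≤ l} is a-priori bounded on [0,t], uniformly in t < T, for every l.
FastClassSqueeze (crux 3): for some
speed level l the middle strain eigenvalue restricted to the fast class lies in a Miller–Serrin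
class L^p_t L^q_x,
2/p + 3/q = 2, q > 3/2. ClassBudgetsRegularise (crux 4, the bridge in `closes`, Clay (A)-form): for
every Clay datum, both budgets at ONE level l
along every classical Leray–Hopf solution from it ⇒ Fefferman (A) for it; its per-solution core is
the support LocalisedMiller
(both at one level ⇒ smooth extension past T: the identity turns fast-class production into
fast-class strain skewness, Miller's
interpolation closes the enstrophy Gronwall), its other half is the per-datum local theory (proved
in tree).
Lean: `SlowClassProduction ∧ FastClassSqueeze` with `SlowClassProduction := ∀ (ν T : ℝ), 0 < ν → 0 <
T → ∀ (u : ℝ → EuclideanSpace ℝ (Fin 3) → EuclideanSpace ℝ (Fin 3)) (p : ℝ → EuclideanSpace ℝ (Fin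
3) → ℝ), Literature.Analysis.FluidPDE.IsClassicalNSSolutionOn (Set.Ico 0 T) ν 0 u p →
Literature.Analysis.FluidPDE.IsLerayHopfOn T ν 0 (u 0) u →
Literature.Analysis.FluidPDE.HasRapidSpatialDecay (u 0) → ∀ l : ℝ, 0 < l → ∃ C : ℝ, ∀ t ∈ Set.Ico 0
T, MeasureTheory.IntegrableOn (fun z : ℝ × EuclideanSpace ℝ (Fin 3) => inner ℝ
(Literature.Analysis.FluidPDE.curl (u z.1) z.2) (fderiv ℝ (u z.1) z.2
(Literature.Analysis.FluidPDE.curl (u z.1) z.2))) {z : ℝ × EuclideanSpace ℝ (Fin 3) | z.1 ∈ Set.Ioo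
0 t ∧ ‖u z.1 z.2‖ ≤ l} ∧ ∫ z in {z : ℝ × EuclideanSpace ℝ (Fin 3) | z.1 ∈ Set.Ioo 0 t ∧ ‖u z.1 z.2‖
≤ l}, inner ℝ (Literature.Analysis.FluidPDE.curl (u z.1) z.2) (fderiv ℝ (u z.1) z.2
(Literature.Analysis.FluidPDE.curl (u z.1) z.2)) ≤ C`

## Assembly
Pure logic plus one kinematic inequality, crux-only (`theorem closes (h₁ : SlowClassProduction) (hX₁
: NoFastEnergyConcentration)
(hX₂ : FastGradientSerrinStarved) (h₃ : ClassBudgetsRegularise) : NavierStokesRegularity`, rev 8,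
native OK, standard axioms):
FIRST the fast-class squeeze is assembled from its two BC2 pieces — along a given flow feed X₁ =
NoFastEnergyConcentration (no
energy quantum escapes to infinite speed) into X₂ = FastGradientSerrinStarved (an energy-starved
fast class has a Miller–Serrin
finite gradient) and take the majorant m := ‖∇u‖, which realises the min–max clause of
FastClassSqueeze on the span of the first
two standard basis vectors (Cauchy–Schwarz, operator norm, Pythagoras); this is literally the
route's glue item
FastClassSqueezeOfSubs (X₁ → X₂ → FastClassSqueeze, PROVED:
Theorems/HodographBetchovFastClassSqueezeSplit.lean, stmt-18129),
re-proved inline because a Theorems file that imports this route file cannot be imported back into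
it. THEN fix ν and a Clay
datum u₀; ClassBudgetsRegularise asks, along every classical solution (u,p) on every [0,T) that is
Leray–Hopf from u(0) = u₀, for
one level l carrying both class budgets; FastClassSqueeze supplies l (with the fast-class Miller
bound) and SlowClassProduction
holds at that l; the bridge returns the global smooth bounded-energy solution. So the load-bearing
open cruxes of `closes` are
SlowClassProduction (r2), FastGradientSerrinStarved (r5) and NoFastEnergyConcentration (r6), with
ClassBudgetsRegularise (r4)
PROVED; FastClassSqueeze (r3) stays in the cone as the derived node X₁ ∧ X₂ ⇒ FastClassSqueeze and
remains claimable directly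
(a direct proof of it makes hX₁, hX₂ redundant via the rev-4 Assembly item, which is the type of the
rev-3–7 `closes` and is
PROVED: hodographBetchov_assembly_proof). History: rev 0 invoked the PROVED shared frame NoBlowup →
Clay
(Theorems.typeICertificateLadder_noBlowupToClay_proof) inside `closes`, importing a Theorems module
whose 587-module cone carries
26 unproved named facts (blocked-by-cone, no provers); rev 1 took the supports LocalisedMiller +
NoBlowupToClay as hypotheses
instead (gate: glue.non-crux-hypothesis); revs 2–7 (glue repair) file the bridge as the rank-4 crux
ClassBudgetsRegularise in
A-form — LocalisedMiller's continuation step and the per-datum local theory in ONE statement over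
the Clay data, the move
PeriodicPortability rev 6 made — and drop this route's copy of NoBlowupToClay (stmt-15607; the frame
stays PROVED in tree as
stmt-0055 / Theorems/NoBlowupToClay.lean `navierStokesRegularity_of_noBlowup`, whose own module cone
is likewise fact-dirty); rev
8 (route-repair 2026-08-17, unused-crux) rewires `closes` through the pieces X₁, X₂ filed flat on
2026-08-17 by the FastClassSqueeze
strategist (BC2 redirect of the summit-equivalent crux 3; `route edit --split` being
final-cycle-gated, the pieces and their glue
were filed as items 18118 / 18120 / 18129 rather than as a registered split), so that both pieces
are load-bearing binders
instead of unused cruxes.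
PROVER NOTES: (i) ClassBudgetsRegularise is PROVED (classBudgetsRegularise_proof: the
`navierStokesRegularity_of_noBlowup`
argument run for the single datum — Kato maximal time, Leray graft, the hypothesis at T = T_max,
LocalisedMiller's enstrophy
Gronwall near T_max); (ii) CONE HYGIENE: a proof of an open crux that imports
Theorems.NoBlowupToClay or the Kato/Leray
fact-bearing FluidPDE modules re-dirties the route's MODULE cone (dispatcher guardrail
`module_cone`); the pieces X₁, X₂ have
registered skeletons under Cruxes/FastClassSqueeze/Lines/ (pieceX1_morrey_nullset: energy Morrey
bound + tightness on an ℋ¹-null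
set; pieceX2_critical_starvation: critical-rate starvation + speed-level ε-regularity) and the
necessity audit
Theorems/HodographBetchovPiecesNecessity.lean (each piece ⟺ NavierStokesRegularity given the tree).
HodographConditioning,
VelocityClassBetchov, DeepSlowGradient (all PROVED) are the engine and the collar reduction,
LocalisedMiller (PROVED) the
per-solution core of crux 4; SlowClassProductionUniform and HodographEpsilonRegularity are carried
variants (supports, not in
the cone of `closes`).

Rationale: WHY THIS LINE. MECHANISM (card hodograph-degree-conditional-betchov-v2, P1 kit-certified
j004667/j004689/j004713/j004719): degree zero of
the hodograph makes g(u)det∇u = div(cof(∇u)ᵀB(u)), div_v B = g, integrate to zero for EVERY bounded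
g (Ball–Currie–Olver null
Lagrangian + Brouwer degree, EvansGariepy2015 §3.3 area formula with multiplicity); combined with
the sl(3) algebra
tr A³ = 3 det A = tr S³ + ¾ ω·Sω (Betchov1956 is g ≡ 1; SqueezeCycle.SignLaw is the pointwise split)
it localises vortex
stretching EXACTLY to the velocity classes a singularity must occupy (|u| must blow up,
hasSmoothExtensionPast_of_bounded;
|F_l| ≤ 2E₀/l²), with no cut-off collar — spatial balls always leave the flux −⅓∫∇φ·cof(∇u)ᵀu (the
collar SqueezeCycle must
import), velocity classes leave nothing. REGULARITY SIDE: on the fast class production = 4∫_F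
λ₂|λ₁λ₃| ≤ 2∫_F λ₂⁺|S|², so
Miller's middle-eigenvalue criterion (Miller2019, NeustupaPenel2001; global in space in print) is
needed ONLY on F_l
(FastClassSqueeze), provided the slow class carries bounded production (SlowClassProduction) — and
deep inside the slow
class it does a priori: |u| ≤ l on a parabolic cylinder of radius ν/l (Reynolds number one) bounds
|∇u| by C l²/ν
(Serrin1962-type local regularity, support DeepSlowGradient), so ∫∫_deep |∇u|³ ≤ (Cl²/ν)·E₀/(2ν);
the whole difficulty of
crux 2 is the (ν/l)-COLLAR of the fast set. Imported areas: degree theory / GMT (area formula with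
multiplicity, null
Lagrangians of nonlinear elasticity), turbulence small-scale phenomenology (Betchov constraints, Q–R
invariants; Carbone–Wilczek
doi:10.1017/jfm.2022.680 classify gradient-ONLY constraints and set the velocity-dependent class
aside), Serrin/Miller-type
conditional regularity (PDE). What no listed route does: a RATE-FREE (no Type-I/II split, no zoom,
no Liouville conjecture)
reduction of Clay (A) to two statements about ONE moving set F_l, through an exact identity that is
false for ℂ³-valued
fields (Li–Sinai) and invisible to averaged bilinear forms; SqueezeCycle (nearest) runs the
pointwise split on parabolic
balls of Type-I models with a collar and closes by a Liouville dichotomy at threshold 1/8;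
OddMorawetz uses Betchov only as
the g ≡ 1 member of its order-3 density span; DirectionEnergy/DirectionDissipationQuantum pivot on
the direction field ξ,
which drops out here. Negatives index (CorrectorSolvable, FiniteTangentModuli,
BlowupClayNonuniqueness): untouched — no
corrector equation, no tangent-flow moduli, no non-uniqueness is used.

RANKED CRUXES. #0 Target (target) — X = SlowClassProduction ∧ FastClassSqueeze: along every
classical Leray–Hopf solution from a rapidly decaying datum on [0,T), (i) for every speed level l >
0 the enstrophy production of the slow class {|u| ≤ l} over [0,t] is bounded uniformly in t < T, and
(ii) for some level l the middle strain eigenvalue restricted to the fast class {|u| > l} lies in a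
Miller–Serrin class L^p_t L^q_x (2/p + 3/q = 2, q > 3/2). (why it might fail: both halves are
critical (scale-invariant) a-priori statements and none is known; (i) fears strained near-stagnant
collars, (ii) fears that fast strained cores are biaxial (λ₂ > 0) as a rule, so it is a
collapse-rate statement.) [Miller2019, Betchov1956, Constantin1990, doi:10.1017/jfm.2022.680]
#2 SlowClassProduction (crux) — SLOW-CLASS PRODUCTION BOUND (card K1): for every ν > 0, T > 0, every
classical solution (u,p) of unforced NS on ℝ³×[0,T) that is Leray–Hopf from a rapidly decaying
datum, and every speed level l > 0, there is C such that for all t < T the production ω·(∇u)ω is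
integrable on the slow space-time class {(s,x) : 0 < s < t, |u(s,x)| ≤ l} with integral ≤ C. By
VelocityClassBetchov this is 4∫∫_slow(−det S) ≤ C; deep inside the slow class it is a priori true
(DeepSlowGradient + energy), so the content is the (ν/l)-parabolic COLLAR of the fast set.
[difficulty: open-problem] (why it might fail: critical; |u| ≤ l bounds gradients only a parabolic
distance ν/l inside the slow set — a strained near-stagnant collar (degenerate stagnation line/sheet
between colliding structures, G²·l·Area → ∞) or a fractal fast set with a fat collar breaks it while
staying energy-class.) [Miller2019, Constantin1990, Serrin1962, Hou2022PotentiallySingularNS,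
Summits/NavierStokesRegularity/NavierStokesRegularity/Ideas/hodograph-degree-conditional-betchov-v2.md]
#3 FastClassSqueeze (crux) — FAST-CLASS SQUEEZE (card K2): for every such solution there are a speed
level l > 0, an exponent q > 3/2 and a nonnegative majorant m(t,x) of the middle strain eigenvalue
on the fast class (min–max form: at every fast point some 2-plane on which the quadratic form of ∇u
is ≤ m) with ‖m·1_{|u|>l}‖ in L^p_t L^q_x finite, p = 2q/(2q−3) (so 2/p + 3/q = 2): Miller's
middle-eigenvalue hypothesis, demanded only on the fast class, where |F_l(t)| ≤ 2E₀/l². [difficulty: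
open-problem] (why it might fail: critical Serrin-class a-priori bound, none known even globally;
strained Burgers-type cores are biaxial (λ₂ = min(γ,|s|−γ/2) > 0) on their whole fast annulus once
Γ/ν ≫ 1, so K2 must come from time-integrability of the fast-class charge during a collapse, not
from a sign.) [Miller2019, NeustupaPenel2001, Chae2005, Hou2022PotentiallySingularNS,
Summits/NavierStokesRegularity/NavierStokesRegularity/Ideas/hodograph-degree-conditional-betchov-v2.md]
#4 ClassBudgetsRegularise (crux) — BETCHOV–MILLER BRIDGE, Clay (A)-form (rev 2; the deciding step of
the crux-only `closes`): for every ν > 0 and every Clay datum u₀ (smooth, divergence-free, rapidly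
decaying): if along EVERY classical solution (u,p) of unforced NS on ℝ³×[0,T), every T > 0, that is
Leray–Hopf from u(0) = u₀, SOME level l > 0 carries both the slow-class bound (conclusion of crux 2
at l) and the fast-class squeeze (conclusion of crux 3 at l), then u₀ launches a global smooth
solution with bounded energy. Content = LocalisedMiller (new conditional regularity: Miller2019 Thm
1.1 is global in x; here λ₂⁺ is demanded only on F_l, via Betchov on velocity classes and Miller's
Lemma 5.1 −det S ≤ ½λ₂⁺|S|²) + per-datum local theory (local classical Leray–Hopf existence, Kato
maximal time, weak–strong uniqueness, continuation — all PROVED in tree,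
Theorems/NoBlowupToClay.lean, but only in fact-dirty modules, hence stated in A-form rather than
imported). [difficulty: L] (why it might fail: not in print; the class split of Z′ needs the
degree-0 hodograph identity for u(t) at every t > 0, valid only once u(t) → 0 and det∇u(t) ∈ L¹ —
i.e. after weak–strong identification of the classical Leray–Hopf solution with the H^k solution —
and the signed slow term enters Gronwall only time-integrated; a gap in the tree's solution classes
(IsClassicalNSSolutionOn carries no decay at t > 0) is where it would show.) [Miller2019,
arXiv:1710.05569 Thm 1.1 / Lemma 5.1, NeustupaPenel2001, Betchov1956, LemarieRieusset2016,
EvansGariepy2015, KNSS2009]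
#9 LocalisedMiller (support) — LOCALISED MILLER (card T2; the per-solution core of crux 4 — a
hypothesis of `closes` only until rev 2 —, provable given VelocityClassBetchov + local theory): for
a classical Leray–Hopf solution from a rapidly decaying datum on [0,T) and a level l > 0, the
slow-class bound (crux 2 at l) and the fast-class squeeze (crux 3 at l) imply a smooth extension
past T. Proof sketch: ½Z' = ∫_slow ω·Sω + ∫_fast ω·Sω − ν‖∇ω‖²; fast = −4∫_F det S ≤ 2∫_F m|∇u|² ≤
‖m1_F‖_q ‖∇u‖²_(2q') ≤ (ν/2)‖∇ω‖² + C‖m1_F‖_q^p Z (Gagliardo–Nirenberg θ = 3/(2q) < 1, Young); slow: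
enters only through its time integral over (0,t), bounded by C uniformly in t < T, so the integral
form of Gronwall Z(t) ≤ Z(0) + 2C + C_q∫₀ᵗ‖m1_F‖_q^p Z suffices; Z bounded on [0,T) ⇒ H¹
continuation. [difficulty: L] [Miller2019, BealeKatoMajda1984, Leray1934, KNSS2009]
#9 HodographConditioning (support) — HODOGRAPH CONDITIONING (card P1(b), provable now, stated at the
generality LocalisedMiller needs — u(t) has only algebraic tails for t > 0): for u ∈ C¹(ℝ³,ℝ³)
tending to 0 at infinity with det∇u ∈ L¹ and every bounded Borel g, ∫ g(u(x)) det∇u(x) dx = 0 (area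
formula with multiplicity: the sum of sign det∇u over u⁻¹(v) is the Brouwer degree at v ≠ 0, which
vanishes by the homotopy su, s ∈ [0,1]; Sard for the null set of critical values; for C² fields also
g(u)det∇u = div(cof(∇u)ᵀB(u)), div_v B = g). Certified numerically on the card (j004689: residual ≤
2·10⁻³ on 40 speed classes vs O(0.1–1) on spatial balls). [difficulty: M] [EvansGariepy2015,
Betchov1956,
Summits/NavierStokesRegularity/NavierStokesRegularity/Ideas/hodograph-degree-conditional-betchov-v2.md]
#9 VelocityClassBetchov (support) — BETCHOV ON VELOCITY CLASSES (card P1(c), provable now from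
HodographConditioning + SqueezeCycle.SignLaw): for C¹ divergence-free u on ℝ³ tending to 0 at
infinity with ∇u ∈ L³ and bounded Borel g, ∫ g(u) ω·(∇u)ω dx = −4 ∫ g(u) det S dx, S = ½(∇u + ∇uᵀ)
(tr∇u = 0 ⇒ det∇u = det S + ¼ω·Sω). The g ≡ 1 case is Betchov 1956. [difficulty: M] [Betchov1956,
Miller2019, doi:10.1017/jfm.2022.680]
#9 DeepSlowGradient (support) — DEEP-SLOW GRADIENT BOUND (card P3; local regularity at Reynolds
number one): for ν, l, A > 0 there is C such that for every classical Leray–Hopf solution from a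
rapidly decaying datum with ∫|u₀|² ≤ A, every t₀ ∈ [ν/l², T) and x₀, if |u| ≤ l on the parabolic
cylinder [t₀ − ν/l², t₀] × B̄(x₀, ν/l) then |∇u(t₀,x₀)| ≤ C (by scaling C = C(A l/ν³)·l²/ν;
canonical pressure: local part from |u| ≤ l, harmonic far part from the energy; then local energy
inequality + Serrin). With the energy bound it makes slow-class production OFF the (ν/l)-collar a
priori integrable — the reduction of crux 2 to its collar. [difficulty: L] [Serrin1962, CKN1982,
KNSS2009]
#9 SlowClassProductionUniform (support) — UNIFORM SLOW-CLASS BOUND (the quantitative,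
kit-falsifiable form of crux 2; not in `closes`): for ν, T, A, l > 0 there is C = C(ν,T,A,l)
bounding the slow-class production on [0,t], t < T, of EVERY classical Leray–Hopf solution from a
rapidly decaying datum with ∫|u₀|² ≤ A and ∫|∇u₀|² ≤ A. A bounded-data family whose slow collars
pump production without bound before a fixed T kills it while the per-solution crux 2 may survive.
[difficulty: open-problem] [Miller2019, Constantin1990, Hou2022PotentiallySingularNS]
#9 HodographEpsilonRegularity (support) — HODOGRAPH ε-REGULARITY (card K3, an independent variant,
not load-bearing): there is ε₀ > 0 such that a classical Leray–Hopf solution from a rapidly decaying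
datum on [0,T) extends smoothly past T provided at every x₀ the time-integrated velocity-space
volume swept (with multiplicity) by small parabolic cylinders under (x₀,T) is small at the critical
rate: ∫_(T−r²/ν)^T ∫_(B_r(x₀)) |det∇u| ≤ ε₀ ν²/r for all small r (scale-invariant; vanishes for
locally 2.5-D gradients, so strictly stronger than CKN's r⁻¹∫∫|∇u|²). [difficulty: open-problem]
[CKN1982, EvansGariepy2015, KNSS2009]
#5 FastGradientSerrinStarved (crux) — IN AN ENERGY-STARVED FAST CLASS THE GRADIENT IS
SERRIN-SQUEEZED (piece X₂ of the BC2 redirect of crux 3, filed 2026-08-17 as stmt-18120; a binder of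
`closes` since rev 8): along every classical Leray–Hopf solution from a rapidly decaying datum on
[0,T), IF the kinetic energy is uniformly integrable over speed classes (the conclusion of #6 for
this flow) THEN for some level l > 0 and exponent q > 3/2 the fast-class velocity gradient is
Miller–Serrin finite, ∫₀ᵀ (∫_{|u(t)|>l} ‖∇u(t,x)‖^q dx)^{2/(2q−3)} dt < ∞ (Beirão da Veiga's ∇u ∈
L^p_t L^q_x, 2/p + 3/q = 2, demanded only on the fast class). Carries the regularity-strength of
crux 3; registered line Cruxes/FastClassSqueeze/Lines/pieceX2_critical_starvation.lean
(critical-rate starvation l·U(l)/ν³ → 0 along a sequence of levels + ε-regularity at infinite speed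
by collar-free De Giorgi over speed levels); kinematic caution landed as
fastGradientSerrinStarved_false_kinematic (the NS hypotheses are load-bearing). [difficulty:
open-problem] (why it might fail: a Type-I-rate collapse is energy-starved (#6 holds) yet its
fast-class gradient Serrin norm is log-divergent, so #5 fails if a Type-I blow-up exists;
speed-level De Giorgi needs critical-rate starvation, not #6's o(1), and its slow-pressure term is
sublinear.) [doi:10.3934/dcdss.2010.3.409, Miller2019, arXiv:1710.05569, arXiv:1705.04420,
Summits/NavierStokesRegularity/NavierStokesRegularity/Cruxes/FastClassSqueeze/Lines/birth.md]
#6 NoFastEnergyConcentration (crux) — NO ENERGY QUANTUM ESCAPES TO INFINITE SPEED (piece X₁,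
stmt-18118; a binder of `closes` since rev 8): along every such solution, for every ε > 0 there is a
speed level l > 0 with ∫_{|u(t)|>l} |u(t,x)|² dx ≤ ε for ALL t ∈ [0,T) — the kinetic energy is
uniformly integrable over speed classes up to the (possibly singular) time T. Energy-level and
Type-I-compatible (it follows from strong L²-continuity into T, landed as
Theorems.FastClassSqueeze.Birth.stub_no_fast_energy_concentration_of_tendsto; hence true at a Type-I
first blow-up time by Leslie–Shvydkoy's energy equality); it fails only for an energy-carrying
strongly Type-II collapse onto the ℋ¹-null singular set. Registered line
Cruxes/FastClassSqueeze/Lines/pieceX1_morrey_nullset.lean (Type-I-in-space energy Morrey bound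
[open, weaker than regularity] + Morrey-bounded energy cannot concentrate on an ℋ¹-null set).
[difficulty: open-problem] (why it might fail: open even as energy equality at the first blow-up
time, known only under Type-I or extra integrability; an energy-carrying Type-II cascade
concentrating a fixed quantum of |u|² at ever higher speeds before T is not excluded by anything in
the tree.) [arXiv:1705.04420, doi:10.1137/16m1104147, CKN1982, doi:10.3934/dcdss.2010.3.409,
Summits/NavierStokesRegularity/NavierStokesRegularity/Cruxes/FastClassSqueeze/Lines/birth.md]
#9 FastClassSqueezeOfSubs (support, PROVED) — GLUE OF THE BC2 REDIRECT: NoFastEnergyConcentration →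
FastGradientSerrinStarved → FastClassSqueeze (feed X₁ into X₂ along the flow; m := ‖∇u‖ majorises
the Rayleigh quotient of ∇u on every 2-plane). Landed as
Theorems/HodographBetchovFastClassSqueezeSplit.lean (fastClassSqueezeOfSubs_proof); re-proved inline
inside the rev-8 `closes`, which cannot import a Theorems file downstream of this route file.
[difficulty: S] [Miller2019,
Summits/NavierStokesRegularity/NavierStokesRegularity/Cruxes/FastClassSqueeze/Split.lean]
DROPPED (rev 5): NoBlowupToClay (support; stmt-NavierStokesRegularity-15607 = the PROVED shared
frame stmt-0055 verbatim, NoBlowup → Clay (A)) — no longer on the closing chain: its per-datum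
content sits inside crux 4 in A-form. Invoking the proof inside `closes` (Theorems.NoBlowupToClay
`navierStokesRegularity_of_noBlowup`, or Theorems.TypeICertificateLadderNoBlowupToClay) imports a
fact-dirty module cone (31 resp. 26 unproved named facts ⇒ blocked-by-cone), and taking it as a
hypothesis trips glue.non-crux-hypothesis (rev 1); the frame itself stays proved in tree for every
other route. [Fefferman2000, Leray1934, LemarieRieusset2016]

TWO-LAYER PLAN. FILED (2026-08-17, flat — `route edit --split` is final-cycle-gated, so the pieces
are top-level items sharing the layer of crux 3, not registered children): FastClassSqueeze ⇐
NoFastEnergyConcentration (#6, X₁) + FastGradientSerrinStarved (#5, X₂) by the PROVED glue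
FastClassSqueezeOfSubs (#9); since rev 8 `closes` consumes X₁ and X₂ directly and derives
FastClassSqueeze inline, so the route's open load-bearing set is {SlowClassProduction,
FastGradientSerrinStarved, NoFastEnergyConcentration} and a direct proof of FastClassSqueeze still
closes the route through the PROVED rev-4 Assembly item. Foreseen glued splits (not filed):
SlowClassProduction ⇐ DeepSlowBound (production off the (ν/l)-parabolic collar of the fast
set is bounded by C(A l/ν³)(l²/ν)·E₀/ν — from DeepSlowGradient + the energy inequality) →
CollarProduction (∫∫ over the collar of
|∇u|³, the real crux) → SlowClassProduction; FastClassSqueeze ⇐ FastClassCharge (time-integrability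
of 4∫_F λ₂⁺|λ₁λ₃| for a
Kelvin-limited collapsing core, charge ∼ νΓ²ℓ/a⁴) → SqueezeToMiller (charge bound on a set of
measure ≤ 2E₀/l² ⇒ an L^pL^q member)
→ FastClassSqueeze; ClassBudgetsRegularise ⇐ LocalisedMiller (per-solution continuation at a common
level) + DatumFrame (per-datum
no-blow-up ⇒ Clay (A): the tree's navierStokesRegularity_of_noBlowup argument run for one datum, the
budgets applied at T = T_max)
→ ClassBudgetsRegularise (k = 2); LocalisedMiller ⇐ VelocityClassBetchov →
EnstrophyGronwallOnClasses → LocalisedMiller (k ≤ 3, depth 1 each).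

KILL CRITERIA. A classical Leray–Hopf solution (or an energy-class family at fixed data norms, for
the uniform form) whose slow-class
production diverges for EVERY l refutes SlowClassProduction — close `refuted:SlowClassProduction`
unless the witness is a
degenerate-stagnation-set symmetry artefact the collar child can exclude (then restate crux 2 on the
collar only). A blow-up
with bounded slow production and fast-class λ₂⁺ outside every Miller class refutes FastClassSqueeze
= ¬A in that scenario.
DNS evidence (Kerr antiparallel, Hou 2022) of ⟨ω·Sω | |u| > l⟩ = −4⟨det S | |u| > l⟩ growing without
bound at the top speed
percentiles at fixed data norms kills the uniform form and puts crux 3 on notice. An error in the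
degree-zero step would kill
the engine — excluded (certified j004689/j004713/j004719 and proved by hand via the null-Lagrangian
divergence form). NoBlowup
proved elsewhere (TypeILiouville target, stmt-0054) moots the route; Miller's criterion localised in
print would make
LocalisedMiller / crux 4 `known` (harmless: crux 4 then re-badges to support and is invoked inside
`closes` once proved cone-clean).

NOT DECOMPOSED YET. The collar statement itself (parabolic (ν/l)-neighbourhood of the fast set; its
measure is NOT controlled by |F_l| ≤ 2E₀/l² for
filamentary fast sets) and the deep-slow bound — children of crux 2 once DeepSlowGradient lands; the
fast-class charge /
collapse-rate statement behind crux 3; the pairing theorem (every regular velocity value ≠ 0 has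
evenly many preimages, half
tube-stretching det∇u > 0, half sheet-forming) and the 2-D shadow ∮_(|u|=λ) ∂ₙp = 0 — consequences
of HodographConditioning, not
items; the scale family ⟨δω·δS·δω + (4/3)tr(δS)³ | δ_r u⟩ = 0; the definition requests (Brouwer
degree / area formula with
multiplicity, speedSuperlevel, detStrain) — every item is inlined over fderiv /
ContinuousLinearMap.det / adjoint for now.

CHEAPEST FALSIFIER. By hand (done on the card, re-checked here): a nondegenerate stagnation point
with gradient G contributes slow-class production
≲ G³·(l/G)³ = l³ per unit time — bounded independently of G — so the feared 'production at u = 0' of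
Taylor–Green / Kida–Pelz
symmetric candidates does NOT break crux 2; only DEGENERATE stagnation sets (lines/sheets,
contribution G²·l·Area) or fat collars
do. Next cheapest (kit, one DNS job): condition ⟨ω·Sω⟩ and −4⟨det S⟩ on speed percentiles along a
Kerr antiparallel-tube or
Taylor–Green run at Re 1000–5000 and track the slow-class share of production as ‖ω‖_∞ grows ×10:
slow share → 1 for every l
kills crux 2; fast-class λ₂⁺ L^(3/2+)-norm growing like a power of ‖ω‖_∞ at fixed data norms kills
the uniform form / strains
crux 3. In-Lean: the sl(3) algebra (SqueezeCycle.SignLaw, a `Matrix.det_fin_three` + `ring`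
exercise) is the only decidable piece.

NUMBERS. |F_l(t)| ≤ 2E₀/l² (Chebyshev); Miller's class 2/p + 3/q = 2, 3/2 < q ≤ ∞ (Miller2019 Thm
1.1); Betchov: ⟨ω·Sω⟩ = −(4/3)⟨tr S³⟩ =
−4⟨det S⟩ (Betchov1956); card numerics: velocity-class residual ∫_(|u|>λ)det∇u / ∫_(|u|>λ)|det∇u| ≤
2·10⁻³ (40 classes, 220³ grid,
j004689), ≤ 8.5·10⁻³ (j004719) against 0.13–0.95 on |ω|-, |S|-, production-super-level sets and
spatial balls; second invariant
does NOT condition (−0.03…−0.31). Deep-slow scale: cylinder radius ν/l, duration ν/l², gradient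
bound C(A l/ν³)·l²/ν. Items at
open: 11 (target, assembly, 2 cruxes, 7 supports); after rev 5: 11 (target, assembly = type of
`closes`, 3 cruxes ranked 2/3/4,
6 supports; ClassBudgetsRegularise added rev 2, Assembly restated rev 4, NoBlowupToClay dropped rev
5). Deciding theorem (rev 3):
crux-only, 3 hypotheses all used, deps 41 constants / 0 unproved, ground flags none. Import cone
(revs 1–5, unchanged): 4 own imports
(ClassicalSolution, LerayHopf, VectorCalculus, NSWave0) + the gate's Statement/HarnessLib, closure
18 project modules, 63 closed named
facts all discharged except the 2 registered Clay decls; rev 0 additionally imported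
Theorems.TypeICertificateLadderNoBlowupToClay (closure 588
modules, 26 unproved named facts — elgindi_euler_blowup, chen_hou_blowup, TypeISingularityExists,
LerayHopfNonUniqueness,
RusinSverakQuestion, tao_quantitative_ess, ess_backward_uniqueness_C1, gkp_*,
albritton_brue_colombo, … — none referenced by
any item: gate deps 0 unproved / 40 constants).

DEFINITION REQUESTS. None blocking: every item is inlined over Literature.Analysis.FluidPDE.{curl,
IsClassicalNSSolutionOn, IsLerayHopfOn,
HasRapidSpatialDecay, HasSmoothExtensionPast, VectorCalculus.IsDivFree} + Mathlib (fderiv,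
ContinuousLinearMap.det, adjoint,
IntegrableOn on ℝ × ℝ³, lintegral, ENNReal rpow). Wanted later (convenience, `--kind definition
--topic
Summits/NavierStokesRegularity/NavierStokesRegularity/Theorems`): speedClass u l t := {x | l < ‖u t
x‖}, production u t x :=
⟪curl (u t) x, fderiv ℝ (u t) x (curl (u t) x)⟫, detStrain; and (Literature/Analysis) the area
formula WITH MULTIPLICITY / Brouwer
degree for C¹ maps ℝⁿ → ℝⁿ (Mathlib has only the injective
`integral_image_eq_integral_abs_det_fderiv_smul`).

Novelty: Searches (2026-08-16, this seat): grep of all 68 Theses files of the sub for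
hodograph/Betchov/velocity-class (3 hits, all the
GLOBAL g ≡ 1 identity: OddMorawetz order-3 span, SqueezeCycle SignLaw, ClockStretchingLaw companion
law); open_routes.json (55)
+ recomb digest (72 routes incl. closed) read entry by entry (levers listed in NOTES.md); `ledger
idea list` (card open,
unrouted, grade new-mechanism); `lit frontier NavierStokesRegularity --since 2024` (30 rows: forward
self-similar,
non-uniqueness, Hou-type numerics, threshold papers — nothing on velocity-space structure); `lit
search --source crossref
"rearrangement vorticity … stretching rate distribution"` (12 rows, Serrin-type
one-component/direction criteria only);
`lit galaxy search "determinant of the velocity gradient" --star all` (3 rows: visualisation/LCS,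
none on conditioning) and `… "conditioned on the local velocity" --star all` (2 rows: Ten Chapters
in Turbulence, Pereira–Garban–Chevillard random fields — velocity-conditioned statistics of
dissipation, not of R or production); remote openalex/s2 rate-limited (HTTP 429) this session — the
card's own searches (2026-08-15/16: galaxy "Betchov" 61 rows,
"Betchov homogeneity constraints", intelligent-mode conditional-average query 25 rows, crossref
Carbone–Wilczek READ §§2,4,5,7,
LMN arXiv:1209.6454 p.15 READ, openalex 'null Lagrangian NS enstrophy velocity level sets' 0) and
the mechanism critic's
reduction attempts (Tran–Yu doi:10.1088/0951-7715/29/10/2990, doi:1  [refs: 10.1088/0951-7715/29/10/2990, 10.1017/jfm.2020.1033, 10.3934/dcdss.2010.3.409, 10.1017/s0022112056000317, 10.1007/s00205-019-01419-z, 10.1017/jfm.2022.680, 1209.6454, doi:10.1088/0951-7715/29/10/2990, doi:10.1017/jfm.2020.1033, doi:10.3934/dcdss.2010.3.409, doi:10.1017/s0022112056000317, doi:10.1007/s00205-019-01419-z, doi:10.1017/jfm.2022.680, Constantin1990, NeustupaPenel2001, Miller2019, Chae20]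

Barriers (technique_class: degree-theory-hodograph, strain-shape-budget): - technique_class: degree-theory-hodograph, strain-shape-budget
- Literature.Barriers.NavierStokesRegularity.TaoAveragedBlowup: evaded at the engine —
HodographConditioning holds for any decaying vector field, but its link to dZ/dt runs through the
EXACT algebra of (ω·∇)u (det∇u null Lagrangian, tr A³ = 3det A on sl(3)), which averaged /
rotated-dilated bilinear forms do not have; no function-space estimate shared with averaged NS is
claimed. Conceded: cruxes 2–3 are critical statements and the bet is structural, not an estimate in
hand.
- Literature.Barriers.NavierStokesRegularity.ComplexNavierStokesBlowup: evaded genuinely — for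
ℂ³-valued fields (Li–Sinai) the global null-Lagrangian identity survives but degree theory, hence
conditioning on {|u| > l}, does not; the g ≡ 1 identity alone would NOT evade it.
- Literature.Barriers.NavierStokesRegularity.EnergySupercriticality: it applies to cruxes 2–3
(scale-invariant a-priori bounds, none known) and is not claimed free; the dimension count is
explicit — the fast class has measure ≤ 2E₀/l² (energy, dimension fixed by l), the deep slow class
is Reynolds-one local theory, and the whole supercritical gap is parked in the (ν/l)-collar (crux 2)
and in the fast-class charge (crux 3).
- Literature.Barriers.NavierStokesRegularity.NavierStokesInequalitySingularSolution: evaded —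
LocalisedMiller uses the vorticity EQUATION (production = dZ/dt + dissipation), false for
Scheffer/Ożański local-energy-inequality fields; the kinematic identit

History (route lifecycle, newest last):
- 2026-08-16T21:16:40Z · rev 4: restated Assembly (stmt-NavierStokesRegularity-15839) — route-repair (glue, gen 2) step 3/4: restate the Assembly item 1:1 to the crux-only 3-chain that `closes` proves (SlowClassProduction → FastClassSqueeze → Class (planner-rrepair-NavierStokesRegularity-Hodogra-897e8e4e-g2-0)
- 2026-08-16T21:18:20Z · rev 5: dropped NoBlowupToClay — route-repair (glue, gen 2) step 4/4: DROP this route's copy of the shared frame NoBlowupToClay (stmt-NavierStokesRegularity-15607, support, = PROVED stmt-0055 v (planner-rrepair-NavierStokesRegularity-Hodogra-897e8e4e-g2-0)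
- 2026-08-24T19:45:03Z · DORMANT — reconciler: no traction for 7 d (last activity route-revised at 2026-08-17T18:40:25Z); parked, not closed — `ledger route dormant route-NavierStokesRegularity-H (operator:999:2693028)
- 2026-08-28T17:25:35Z · REACTIVATED — reconciler: reactivated — activity item-evidence-added at 2026-08-28T14:12:15Z after parking at 2026-08-24T19:45:03Z (operator:999:1583128)
- 2026-09-03T05:49:12Z · DORMANT — reconciler: no traction for 5 d (last activity statement-checked at 2026-08-29T04:58:43Z); parked, not closed — `ledger route dormant route-NavierStokesRegulari (operator:999:204608)

sub-problem: NavierStokesRegularity · status: dormant · opened planner-plan-novel-NavierStokesRegularity-Navie-a989c6c0-v2-g3-0 2026-08-16T17:33:26Z · rev 8 · ledger route-NavierStokesRegularity-HodographBetchov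
GENERATED by the gate from the ledger (D-0016/17). Provers cite these decls: `theorem foo : Summit.NavierStokesRegularity.NavierStokesRegularity.Theses.HodographBetchov.<Decl> := …` in Summits/NavierStokesRegularity/NavierStokesRegularity/Theorems/<Name>.lean.
-/

namespace Summit.NavierStokesRegularity.NavierStokesRegularity.Theses.HodographBetchov

open scoped BigOperators Topology Manifold Classical MeasureTheory ProbabilityTheory Matrix InnerProductSpace ComplexConjugate ContinuousMap
open Filter Set Function TopologicalSpace MeasureTheory

attribute [summit_statement] _root_.NavierStokesRegularity

open Literature.NS

/-- item stmt-NavierStokesRegularity-15830 · target · rank 0 · open · by planner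
why it might fail: both halves are critical (scale-invariant) a-priori statements and none is known; (i) fears strained near-stagnant collars, (ii) fears that fast strained cores are biaxial (λ₂ > 0) as a rule, so it is a collapse-rate statement.
sources: Miller2019, Betchov1956, Constantin1990, doi:10.1017/jfm.2022.680
[target] X = SlowClassProduction ∧ FastClassSqueeze: along every classical Leray–Hopf solution from
a rapidly decaying datum on [0,T), (i) for every speed level l > 0 the enstrophy production of the
slow class {|u| ≤ l} over [0,t] is bounded uniformly in t < T, and (ii) for some level l the middle
strain eigenvalue restricted to the fast class {|u| > l} lies in a Miller–Serrin class L^p_t L^q_x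
(2/p + 3/q = 2, q > 3/2). -/
@[route_item "route-NavierStokesRegularity-HodographBetchov"]
def Target : Prop :=
  (∀ (ν T : ℝ), 0 < ν → 0 < T → ∀ (u : ℝ → EuclideanSpace ℝ (Fin 3) → EuclideanSpace ℝ (Fin 3)) (p : ℝ → EuclideanSpace ℝ (Fin 3) → ℝ), Literature.Analysis.FluidPDE.IsClassicalNSSolutionOn (Set.Ico 0 T) ν 0 u p → Literature.Analysis.FluidPDE.IsLerayHopfOn T ν 0 (u 0) u → Literature.Analysis.FluidPDE.HasRapidSpatialDecay (u 0) → ∀ l : ℝ, 0 < l → ∃ C : ℝ, ∀ t ∈ Set.Ico 0 T, MeasureTheory.IntegrableOn (fun z : ℝ × EuclideanSpace ℝ (Fin 3) => inner ℝ (Literature.Analysis.FluidPDE.curl (u z.1) z.2) (fderiv ℝ (u z.1) z.2 (Literature.Analysis.FluidPDE.curl (u z.1) z.2))) {z : ℝ × EuclideanSpace ℝ (Fin 3) | z.1 ∈ Set.Ioo 0 t ∧ ‖u z.1 z.2‖ ≤ l} ∧ ∫ z in {z : ℝ × EuclideanSpace ℝ (Fin 3) | z.1 ∈ Set.Ioo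 0 t ∧ ‖u z.1 z.2‖ ≤ l}, inner ℝ (Literature.Analysis.FluidPDE.curl (u z.1) z.2) (fderiv ℝ (u z.1) z.2 (Literature.Analysis.FluidPDE.curl (u z.1) z.2)) ≤ C) ∧ (∀ (ν T : ℝ), 0 < ν → 0 < T → ∀ (u : ℝ → EuclideanSpace ℝ (Fin 3) → EuclideanSpace ℝ (Fin 3)) (p : ℝ → EuclideanSpace ℝ (Fin 3) → ℝ), Literature.Analysis.FluidPDE.IsClassicalNSSolutionOn (Set.Ico 0 T) ν 0 u p → Literature.Analysis.FluidPDE.IsLerayHopfOn T ν 0 (u 0) u → Literature.Analysis.FluidPDE.HasRapidSpatialDecay (u 0) → ∃ l : ℝ, 0 < l ∧ ∃ q : ℝ, 3 / 2 < q ∧ ∃ m : ℝ → EuclideanSpace ℝ (Fin 3) → ℝ, (∀ t x, 0 ≤ m t x) ∧ (∀ t ∈ Set.Ico 0 T, ∀ x, l < ‖u t x‖ → ∃ v w : EuclideanSpace ℝ (Fin 3), ‖v‖ = 1 ∧ ‖w‖ = 1 ∧ inner ℝ v w = 0 ∧ ∀ α β : ℝ, inner ℝ (fderiv ℝ (u t)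 x (α • v + β • w)) (α • v + β • w) ≤ m t x * (α ^ 2 + β ^ 2)) ∧ ∫⁻ t in Set.Ioo 0 T, (∫⁻ x in {x : EuclideanSpace ℝ (Fin 3) | l < ‖u t x‖}, ENNReal.ofReal (m t x) ^ q) ^ (2 / (2 * q - 3)) < ⊤)

/-- item stmt-NavierStokesRegularity-15831 · crux · rank 2 · open · by planner
why it might fail: critical; |u| ≤ l bounds gradients only a parabolic distance ν/l inside the slow set — a strained near-stagnant collar (degenerate stagnation line/sheet between colliding structures, G²·l·Area → ∞) or a fractal fast set with a fat collar breaks it while staying energy-class.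
sources: Miller2019, Constantin1990, Serrin1962, Hou2022PotentiallySingularNS, Summits/NavierStokesRegularity/NavierStokesRegularity/Ideas/hodograph-degree-conditional-betchov-v2.md
[crux] SLOW-CLASS PRODUCTION BOUND (card K1): for every ν > 0, T > 0, every classical solution (u,p)
of unforced NS on ℝ³×[0,T) that is Leray–Hopf from a rapidly decaying datum, and every speed level l
> 0, there is C such that for all t < T the production ω·(∇u)ω is integrable on the slow space-time
class {(s,x) : 0 < s < t, |u(s,x)| ≤ l} with integral ≤ C. By VelocityClassBetchov this is
4∫∫_slow(−det S) ≤ C; deep inside the slow class it is a priori true (DeepSlowGradient + energy), so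
the content is the (ν/l)-parabolic COLLAR of the fast set. [difficulty: open-problem] -/
@[route_item "route-NavierStokesRegularity-HodographBetchov"]
def SlowClassProduction : Prop :=
  ∀ (ν T : ℝ), 0 < ν → 0 < T → ∀ (u : ℝ → EuclideanSpace ℝ (Fin 3) → EuclideanSpace ℝ (Fin 3)) (p : ℝ → EuclideanSpace ℝ (Fin 3) → ℝ), Literature.Analysis.FluidPDE.IsClassicalNSSolutionOn (Set.Ico 0 T) ν 0 u p → Literature.Analysis.FluidPDE.IsLerayHopfOn T ν 0 (u 0) u → Literature.Analysis.FluidPDE.HasRapidSpatialDecay (u 0) → ∀ l : ℝ, 0 < l → ∃ C : ℝ, ∀ t ∈ Set.Ico 0 T, MeasureTheory.IntegrableOn (fun z : ℝ × EuclideanSpace ℝ (Fin 3) => inner ℝ (Literature.Analysis.FluidPDE.curl (u z.1) z.2) (fderiv ℝ (u z.1) z.2 (Literature.Analysis.FluidPDE.curl (u z.1) z.2))) {z : ℝ × EuclideanSpace ℝ (Fin 3) | z.1 ∈ Set.Ioo 0 t ∧ ‖u z.1 z.2‖ ≤ l} ∧ ∫ z in {z : ℝ × EuclideanSpace ℝ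 (Fin 3) | z.1 ∈ Set.Ioo 0 t ∧ ‖u z.1 z.2‖ ≤ l}, inner ℝ (Literature.Analysis.FluidPDE.curl (u z.1) z.2) (fderiv ℝ (u z.1) z.2 (Literature.Analysis.FluidPDE.curl (u z.1) z.2)) ≤ C

/-- item stmt-NavierStokesRegularity-15832 · crux · rank 3 · open · by planner
why it might fail: critical Serrin-class a-priori bound, none known even globally; strained Burgers-type cores are biaxial (λ₂ = min(γ,|s|−γ/2) > 0) on their whole fast annulus once Γ/ν ≫ 1, so K2 must come from time-integrability of the fast-class charge during a collapse, not from a sign.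
sources: Miller2019, NeustupaPenel2001, Chae2005, Hou2022PotentiallySingularNS, Summits/NavierStokesRegularity/NavierStokesRegularity/Ideas/hodograph-degree-conditional-betchov-v2.md
[crux] FAST-CLASS SQUEEZE (card K2): for every such solution there are a speed level l > 0, an
exponent q > 3/2 and a nonnegative majorant m(t,x) of the middle strain eigenvalue on the fast class
(min–max form: at every fast point some 2-plane on which the quadratic form of ∇u is ≤ m) with
‖m·1_{|u|>l}‖ in L^p_t L^q_x finite, p = 2q/(2q−3) (so 2/p + 3/q = 2): Miller's middle-eigenvalue
hypothesis, demanded only on the fast class, where |F_l(t)| ≤ 2E₀/l². [difficulty: open-problem] -/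
@[route_item "route-NavierStokesRegularity-HodographBetchov"]
def FastClassSqueeze : Prop :=
  ∀ (ν T : ℝ), 0 < ν → 0 < T → ∀ (u : ℝ → EuclideanSpace ℝ (Fin 3) → EuclideanSpace ℝ (Fin 3)) (p : ℝ → EuclideanSpace ℝ (Fin 3) → ℝ), Literature.Analysis.FluidPDE.IsClassicalNSSolutionOn (Set.Ico 0 T) ν 0 u p → Literature.Analysis.FluidPDE.IsLerayHopfOn T ν 0 (u 0) u → Literature.Analysis.FluidPDE.HasRapidSpatialDecay (u 0) → ∃ l : ℝ, 0 < l ∧ ∃ q : ℝ, 3 / 2 < q ∧ ∃ m : ℝ → EuclideanSpace ℝ (Fin 3) → ℝ, (∀ t x, 0 ≤ m t x) ∧ (∀ t ∈ Set.Ico 0 T, ∀ x, l < ‖u t x‖ → ∃ v w : EuclideanSpace ℝ (Fin 3), ‖v‖ = 1 ∧ ‖w‖ = 1 ∧ inner ℝ v w = 0 ∧ ∀ α β : ℝ, inner ℝ (fderiv ℝ (u t) x (α • v + β • w)) (α • v + β • w) ≤ m t x * (α ^ 2 + β ^ 2)) ∧ ∫⁻ t in Set.Ioo 0 T, (∫⁻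 x in {x : EuclideanSpace ℝ (Fin 3) | l < ‖u t x‖}, ENNReal.ofReal (m t x) ^ q) ^ (2 / (2 * q - 3)) < ⊤

/-- item stmt-NavierStokesRegularity-16863 · crux · rank 4 · closed · proved by Summit.NavierStokesRegularity.NavierStokesRegularity.Theorems.classBudgetsRegularise_proof @ 738a9fa19eaa (prover) · by planner
why it might fail: Not in print (Miller2019 Thm 1.1 is global in x): the class split of Z' needs Betchov on velocity classes at each t>0, i.e. the degree-0 hodograph identity for u(t), valid only once u(t)→0, det∇u(t)∈L¹ (weak–strong identification); and the signed slow term enters Gronwall only time-integrated.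
sources: Miller2019, arXiv:1710.05569 (Thm 1.1, Lemma 5.1), NeustupaPenel2001, Betchov1956, LemarieRieusset2016, EvansGariepy2015
[crux] BETCHOV–MILLER BRIDGE in Clay (A)-form (the deciding step of `closes`; card T2 + local
theory; rev 2 glue repair): for every ν > 0 and every Clay datum u₀ (smooth, divergence-free,
rapidly decaying): if along EVERY classical solution (u,p) of unforced NS on ℝ³×[0,T), every T > 0,
that is Leray–Hopf from u(0) = u₀, SOME speed level l > 0 carries both a bounded slow-class
production (the conclusion of crux SlowClassProduction at l) and a Miller–Serrin fast-class squeeze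
(the conclusion of crux FastClassSqueeze at l), then u₀ launches a global smooth solution with
bounded energy (Fefferman (A) for u₀). Content = LocalisedMiller (per-solution core, kept as
support: Betchov on velocity classes turns fast-class production into −4∫_F det S ≤ 2∫_F λ₂⁺|S|²
(Miller2019 Lemma 5.1), Miller's Gagliardo–Nirenberg/Young step and Gronwall bound the enstrophy on
[0,T), H¹ continuation) + the standard per-datum local theory (local classical Leray–Hopf existence,
Kato maximal time, weak–strong uniqueness, continuation; all PROVED in tree —
Theorems/NoBlowupToClay.lean `navierStokesRegularity_of_noBlowup` — but only in modules whose import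
cone carries unproved named facts, so the frame is stat -/
@[route_item "route-NavierStokesRegularity-HodographBetchov"]
def ClassBudgetsRegularise : Prop :=
  ∀ ν : ℝ, 0 < ν → ∀ u₀ : EuclideanSpace ℝ (Fin 3) → EuclideanSpace ℝ (Fin 3), ContDiff ℝ (⊤ : ℕ∞) u₀ → Literature.Analysis.FluidPDE.NSWave0.IsDivFree u₀ → Literature.Analysis.FluidPDE.HasRapidSpatialDecay u₀ → (∀ T : ℝ, 0 < T → ∀ (u : ℝ → EuclideanSpace ℝ (Fin 3) → EuclideanSpace ℝ (Fin 3)) (p : ℝ → EuclideanSpace ℝ (Fin 3) → ℝ), Literature.Analysis.FluidPDE.IsClassicalNSSolutionOn (Set.Ico 0 T) ν 0 u p → Literature.Analysis.FluidPDE.IsLerayHopfOn T ν 0 (u 0) u → u 0 = u₀ → ∃ l : ℝ, 0 < l ∧ (∃ C : ℝ, ∀ t ∈ Set.Ico 0 T, MeasureTheory.IntegrableOn (fun z : ℝ × EuclideanSpace ℝ (Fin 3) => inner ℝ (Literature.Analysis.FluidPDE.curl (u z.1) z.2) (fderiv ℝ (u z.1) z.2 (Literature.Analysis.FluidPDE.curl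 (u z.1) z.2))) {z : ℝ × EuclideanSpace ℝ (Fin 3) | z.1 ∈ Set.Ioo 0 t ∧ ‖u z.1 z.2‖ ≤ l} ∧ ∫ z in {z : ℝ × EuclideanSpace ℝ (Fin 3) | z.1 ∈ Set.Ioo 0 t ∧ ‖u z.1 z.2‖ ≤ l}, inner ℝ (Literature.Analysis.FluidPDE.curl (u z.1) z.2) (fderiv ℝ (u z.1) z.2 (Literature.Analysis.FluidPDE.curl (u z.1) z.2)) ≤ C) ∧ (∃ q : ℝ, 3 / 2 < q ∧ ∃ m : ℝ → EuclideanSpace ℝ (Fin 3) → ℝ, (∀ t x, 0 ≤ m t x) ∧ (∀ t ∈ Set.Ico 0 T, ∀ x, l < ‖u t x‖ → ∃ v w : EuclideanSpace ℝ (Fin 3), ‖v‖ = 1 ∧ ‖w‖ = 1 ∧ inner ℝ v w = 0 ∧ ∀ α β : ℝ, inner ℝ (fderiv ℝ (u t) x (α • v + β • w)) (α • v + β • w) ≤ m t x * (α ^ 2 + β ^ 2)) ∧ ∫⁻ t in Set.Ioo 0 T, (∫⁻ x in {x : EuclideanSpace ℝ (Fin 3) | l < ‖u t x‖}, ENNReal.ofReal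 (m t x) ^ q) ^ (2 / (2 * q - 3)) < ⊤)) → ∃ (u : ℝ → EuclideanSpace ℝ (Fin 3) → EuclideanSpace ℝ (Fin 3)) (p : ℝ → EuclideanSpace ℝ (Fin 3) → ℝ), Literature.Analysis.FluidPDE.IsSmoothOnHalfSpace u ∧ Literature.Analysis.FluidPDE.IsSmoothOnHalfSpace p ∧ Literature.Analysis.FluidPDE.IsNavierStokesSolution ν 0 u₀ u p ∧ Literature.Analysis.FluidPDE.HasBoundedEnergy u

-- `ClassBudgetsRegularise` holds: proved by `Summit.NavierStokesRegularity.NavierStokesRegularity.Theorems.classBudgetsRegularise_proof` @ 738a9fa19eaa (its module imports this route file, so no `_holds` link can be stated here).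

/-- item stmt-NavierStokesRegularity-18120 · crux · rank 5 · open · by planner
why it might fail: Regularity-strength: a Type-I-rate collapse is energy-starved (X₁ holds) yet its fast-class gradient Serrin norm is log-divergent, so X₂ fails if a Type-I blow-up exists; speed-level De Giorgi needs critical-rate starvation l·U(l)/ν³ ≪ 1 (not X₁'s o(1)) and its slow-pressure term is sublinear.
sources: doi:10.3934/dcdss.2010.3.409, Miller2019, arXiv:1710.05569, arXiv:1705.04420, Summits/NavierStokesRegularity/NavierStokesRegularity/Cruxes/FastClassSqueeze/Lines/birth.md
[crux] IN AN ENERGY-STARVED FAST CLASS THE GRADIENT IS SERRIN-SQUEEZED (piece X₂ of the BC2 split of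
FastClassSqueeze; verbatim the vetted stub `stub_fast_gradient_serrin_of_no_concentration` of
Cruxes/FastClassSqueeze/Lines/birth.lean): along every classical Leray–Hopf solution from a rapidly
decaying datum on [0,T), IF the kinetic energy is uniformly integrable over speed classes (the
conclusion of NoFastEnergyConcentration for this flow) THEN for some level l > 0 and exponent q >
3/2 the fast-class velocity gradient lies in the Miller–Serrin class, ∫₀ᵀ (∫_{|u(t)|>l} ‖∇u(t,x)‖^q
dx)^{2/(2q−3)} dt < ∞ (Beirão da Veiga's ∇u ∈ L^p_t L^q_x, 2/p+3/q = 2, demanded only on the fast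
class, |F_l(t)| ≤ 2E₀/l²). With X₁ it gives FastClassSqueeze by the sorry-free glue
fastClassSqueeze_of_subs (m := ‖∇u‖ majorises the Rayleigh quotient of ∇u on every 2-plane;
Cruxes/FastClassSqueeze/Split.lean). This piece carries the regularity-strength of the crux (the
energy-concentration scenario having gone to X₁). Registered line: Lines/critical-starvation
(critical-rate starvation l·U(l)/ν³ → 0 along a sequence of levels [open, a-priori] + ε-regularity
at infinite speed by collar-free De Giorgi over s -/
@[route_item "route-NavierStokesRegularity-HodographBetchov"]
def FastGradientSerrinStarved : Prop :=
  ∀ (ν T : ℝ), 0 < ν → 0 < T → ∀ (u : ℝ → EuclideanSpace ℝ (Fin 3) → EuclideanSpace ℝ (Fin 3)) (p : ℝ → EuclideanSpace ℝ (Fin 3) → ℝ), Literature.Analysis.FluidPDE.IsClassicalNSSolutionOn (Set.Ico 0 T) ν 0 u p → Literature.Analysis.FluidPDE.IsLerayHopfOn T ν 0 (u 0) u → Literature.Analysis.FluidPDE.HasRapidSpatialDecay (u 0) → (∀ ε : ℝ, 0 < ε → ∃ l : ℝ, 0 < l ∧ ∀ t ∈ Set.Ico 0 T, ∫⁻ x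 in {x : EuclideanSpace ℝ (Fin 3) | l < ‖u t x‖}, ‖u t x‖ₑ ^ 2 ≤ ENNReal.ofReal ε) → ∃ l : ℝ, 0 < l ∧ ∃ q : ℝ, 3 / 2 < q ∧ ∫⁻ t in Set.Ioo 0 T, (∫⁻ x in {x : EuclideanSpace ℝ (Fin 3) | l < ‖u t x‖}, ENNReal.ofReal ‖fderiv ℝ (u t) x‖ ^ q) ^ (2 / (2 * q - 3)) < ⊤

/-- item stmt-NavierStokesRegularity-18118 · crux · rank 6 · open · by planner
why it might fail: Open even as energy equality at the first blow-up time (Leslie–Shvydkoy 2018: known only under Type-I or extra L^qL^p integrability); an energy-carrying strongly Type-II collapse onto the ℋ¹-null set Σ_T (scaled energy r⁻¹∫_{B_r}|u|² → ∞) breaks it and nothing in print excludes that.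
sources: arXiv:1705.04420, doi:10.1137/16m1104147, CKN1982, doi:10.3934/dcdss.2010.3.409, Summits/NavierStokesRegularity/NavierStokesRegularity/Cruxes/FastClassSqueeze/Lines/birth.md
[crux] NO ENERGY QUANTUM ESCAPES TO INFINITE SPEED (piece X₁ of the BC2 split of FastClassSqueeze;
verbatim the vetted stub `stub_no_fast_energy_concentration` of
Cruxes/FastClassSqueeze/Lines/birth.lean): along every classical solution of unforced NS on ℝ³×[0,T)
that is Leray–Hopf from a rapidly decaying datum, for every ε > 0 there is a speed level l > 0 with
∫_{|u(t)|>l} |u(t,x)|² dx ≤ ε for ALL t ∈ [0,T) — the kinetic energy is uniformly integrable over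
speed classes up to the (possibly singular) time T. ENERGY-level and Type-I-COMPATIBLE: it follows
from strong L²-continuity into T (landed:
Theorems.FastClassSqueeze.Birth.stub_no_fast_energy_concentration_of_tendsto), hence holds for every
Type-I-in-time blow-up (Leslie–Shvydkoy, ARMA 230 (2018) Thm 1.2: energy equality at the first
blow-up time) and under Lions L⁴L⁴ / Kukavica p ∈ L²L² / Leslie–Shvydkoy L^qL^p regions; by the
landed localisation (Σ_T compact, ℋ¹-null, fast class inside any neighbourhood of Σ_T for large l)
it fails only for an energy-carrying strongly Type-II collapse onto Σ_T. Registered line: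
Lines/morrey-nullset (Type-I-in-space energy Morrey bound [open, weaker than regularity] +
Morrey-bounded energy can -/
@[route_item "route-NavierStokesRegularity-HodographBetchov"]
def NoFastEnergyConcentration : Prop :=
  ∀ (ν T : ℝ), 0 < ν → 0 < T → ∀ (u : ℝ → EuclideanSpace ℝ (Fin 3) → EuclideanSpace ℝ (Fin 3)) (p : ℝ → EuclideanSpace ℝ (Fin 3) → ℝ), Literature.Analysis.FluidPDE.IsClassicalNSSolutionOn (Set.Ico 0 T) ν 0 u p → Literature.Analysis.FluidPDE.IsLerayHopfOn T ν 0 (u 0) u → Literature.Analysis.FluidPDE.HasRapidSpatialDecay (u 0) → ∀ ε : ℝ, 0 < ε → ∃ l : ℝ, 0 < l ∧ ∀ t ∈ Set.Ico 0 T, ∫⁻ x in {x : EuclideanSpace ℝ (Fin 3) | l < ‖u t x‖}, ‖u t x‖ₑ ^ 2 ≤ ENNReal.ofReal ε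

/-- item stmt-NavierStokesRegularity-15833 · support · rank 9 · closed · proved by Summit.NavierStokesRegularity.NavierStokesRegularity.Theorems.localisedMiller_proof @ 6eda088c645b (prover) · by planner
sources: Miller2019, BealeKatoMajda1984, Leray1934, KNSS2009
[support] LOCALISED MILLER (card T2; the glue used by `closes`, provable given VelocityClassBetchov
+ local theory): for a classical Leray–Hopf solution from a rapidly decaying datum on [0,T) and a
level l > 0, the slow-class bound (crux 2 at l) and the fast-class squeeze (crux 3 at l) imply a
smooth extension past T. Proof sketch: ½Z' = ∫_slow ω·Sω + ∫_fast ω·Sω − ν‖∇ω‖²; fast = −4∫_F det S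
≤ 2∫_F m|∇u|² ≤ ‖m1_F‖_q ‖∇u‖²_(2q') ≤ (ν/2)‖∇ω‖² + C‖m1_F‖_q^p Z (Gagliardo–Nirenberg θ = 3/(2q) <
1, Young); slow: signed with bounded primitive, absorbed by the second mean-value theorem in
Gronwall; Z bounded on [0,T) ⇒ H¹ continuation. [difficulty: L] -/
@[route_item "route-NavierStokesRegularity-HodographBetchov"]
def LocalisedMiller : Prop :=
  ∀ (ν T : ℝ), 0 < ν → 0 < T → ∀ (u : ℝ → EuclideanSpace ℝ (Fin 3) → EuclideanSpace ℝ (Fin 3)) (p : ℝ → EuclideanSpace ℝ (Fin 3) → ℝ), Literature.Analysis.FluidPDE.IsClassicalNSSolutionOn (Set.Ico 0 T) ν 0 u p → Literature.Analysis.FluidPDE.IsLerayHopfOn T ν 0 (u 0) u → Literature.Analysis.FluidPDE.HasRapidSpatialDecay (u 0) → ∀ l : ℝ, 0 < l → (∃ C : ℝ, ∀ t ∈ Set.Ico 0 T, MeasureTheory.IntegrableOn (fun z : ℝ × EuclideanSpace ℝ (Fin 3) => inner ℝ (Literature.Analysis.FluidPDE.curl (u z.1) z.2) (fderiv ℝ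 (u z.1) z.2 (Literature.Analysis.FluidPDE.curl (u z.1) z.2))) {z : ℝ × EuclideanSpace ℝ (Fin 3) | z.1 ∈ Set.Ioo 0 t ∧ ‖u z.1 z.2‖ ≤ l} ∧ ∫ z in {z : ℝ × EuclideanSpace ℝ (Fin 3) | z.1 ∈ Set.Ioo 0 t ∧ ‖u z.1 z.2‖ ≤ l}, inner ℝ (Literature.Analysis.FluidPDE.curl (u z.1) z.2) (fderiv ℝ (u z.1) z.2 (Literature.Analysis.FluidPDE.curl (u z.1) z.2)) ≤ C) → (∃ q : ℝ, 3 / 2 < q ∧ ∃ m : ℝ → EuclideanSpace ℝ (Fin 3) → ℝ, (∀ t x, 0 ≤ m t x) ∧ (∀ t ∈ Set.Ico 0 T, ∀ x, l < ‖u t x‖ → ∃ v w : EuclideanSpace ℝ (Fin 3), ‖v‖ = 1 ∧ ‖w‖ = 1 ∧ inner ℝ v w = 0 ∧ ∀ α β : ℝ, inner ℝ (fderiv ℝ (u t) x (α • v + β • w)) (α • v + β • w) ≤ m t x * (α ^ 2 + β ^ 2)) ∧ ∫⁻ t in Set.Ioo 0 T, (∫⁻ x in {x : EuclideanSpace ℝ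 (Fin 3) | l < ‖u t x‖}, ENNReal.ofReal (m t x) ^ q) ^ (2 / (2 * q - 3)) < ⊤) → Literature.Analysis.FluidPDE.HasSmoothExtensionPast ν 0 u T

-- `LocalisedMiller` holds: proved by `Summit.NavierStokesRegularity.NavierStokesRegularity.Theorems.localisedMiller_proof` @ 6eda088c645b (its module imports this route file, so no `_holds` link can be stated here).

/-- item stmt-NavierStokesRegularity-15834 · support · rank 9 · closed · proved by Summit.NavierStokesRegularity.NavierStokesRegularity.Theorems.hodographConditioning_proof @ ad431ff80f45 (prover) · by planner
sources: EvansGariepy2015, Betchov1956, Summits/NavierStokesRegularity/NavierStokesRegularity/Ideas/hodograph-degree-conditional-betchov-v2.md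
[support] HODOGRAPH CONDITIONING (card P1(b), provable now, stated at the generality LocalisedMiller
needs — u(t) has only algebraic tails for t > 0): for u ∈ C¹(ℝ³,ℝ³) tending to 0 at infinity with
det∇u ∈ L¹ and every bounded Borel g, ∫ g(u(x)) det∇u(x) dx = 0 (area formula with multiplicity: the
sum of sign det∇u over u⁻¹(v) is the Brouwer degree at v ≠ 0, which vanishes by the homotopy su, s ∈
[0,1]; Sard for the null set of critical values; for C² fields also g(u)det∇u = div(cof(∇u)ᵀB(u)),
div_v B = g). Certified numerically on the card (j004689: residual ≤ 2·10⁻³ on 40 speed classes vs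
O(0.1–1) on spatial balls). [difficulty: M] -/
@[route_item "route-NavierStokesRegularity-HodographBetchov"]
def HodographConditioning : Prop :=
  ∀ (u : EuclideanSpace ℝ (Fin 3) → EuclideanSpace ℝ (Fin 3)), ContDiff ℝ 1 u → Filter.Tendsto u (Filter.cocompact (EuclideanSpace ℝ (Fin 3))) (nhds 0) → MeasureTheory.Integrable (fun x => (fderiv ℝ u x).det) → ∀ g : EuclideanSpace ℝ (Fin 3) → ℝ, Measurable g → (∃ B : ℝ, ∀ v, |g v| ≤ B) → ∫ x, g (u x) * (fderiv ℝ u x).det = 0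

-- `HodographConditioning` holds: proved by `Summit.NavierStokesRegularity.NavierStokesRegularity.Theorems.hodographConditioning_proof` @ ad431ff80f45 (its module imports this route file, so no `_holds` link can be stated here).

/-- item stmt-NavierStokesRegularity-15835 · support · rank 9 · closed · proved by Summit.NavierStokesRegularity.NavierStokesRegularity.Theorems.velocityClassBetchov_proof @ 0b57a74b88db (prover) · by planner
sources: Betchov1956, Miller2019, doi:10.1017/jfm.2022.680
[support] BETCHOV ON VELOCITY CLASSES (card P1(c), provable now from HodographConditioning +
SqueezeCycle.SignLaw): for C¹ divergence-free u on ℝ³ tending to 0 at infinity with ∇u ∈ L³ and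
bounded Borel g, ∫ g(u) ω·(∇u)ω dx = −4 ∫ g(u) det S dx, S = ½(∇u + ∇uᵀ) (tr∇u = 0 ⇒ det∇u = det S +
¼ω·Sω). The g ≡ 1 case is Betchov 1956. [difficulty: M] -/
@[route_item "route-NavierStokesRegularity-HodographBetchov"]
def VelocityClassBetchov : Prop :=
  ∀ (u : EuclideanSpace ℝ (Fin 3) → EuclideanSpace ℝ (Fin 3)), ContDiff ℝ 1 u → Filter.Tendsto u (Filter.cocompact (EuclideanSpace ℝ (Fin 3))) (nhds 0) → MeasureTheory.Integrable (fun x => ‖fderiv ℝ u x‖ ^ 3) → Literature.Analysis.FluidPDE.VectorCalculus.IsDivFree u → ∀ g : EuclideanSpace ℝ (Fin 3) → ℝ, Measurable g → (∃ B : ℝ, ∀ v, |g v| ≤ B) → ∫ x, g (u x) * inner ℝ (Literature.Analysis.FluidPDE.curl u x) (fderiv ℝ u x (Literature.Analysis.FluidPDE.curl u x)) = -4 * ∫ x, g (u x) * (((1 / 2 : ℝ) • (fderiv ℝ u x + ContinuousLinearMap.adjoint (fderiv ℝ u x))).det)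

-- `VelocityClassBetchov` holds: proved by `Summit.NavierStokesRegularity.NavierStokesRegularity.Theorems.velocityClassBetchov_proof` @ 0b57a74b88db (its module imports this route file, so no `_holds` link can be stated here).

/-- item stmt-NavierStokesRegularity-15836 · support · rank 9 · closed · proved by Summit.NavierStokesRegularity.NavierStokesRegularity.Theorems.deepSlowGradient_proof @ 45b98f1133a7 (prover) · by planner
sources: Serrin1962, CKN1982, KNSS2009
[support] DEEP-SLOW GRADIENT BOUND (card P3; local regularity at Reynolds number one): for ν, l, A >
0 there is C such that for every classical Leray–Hopf solution from a rapidly decaying datum with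
∫|u₀|² ≤ A, every t₀ ∈ [ν/l², T) and x₀, if |u| ≤ l on the parabolic cylinder [t₀ − ν/l², t₀] ×
B̄(x₀, ν/l) then |∇u(t₀,x₀)| ≤ C (by scaling C = C(A l/ν³)·l²/ν; canonical pressure: local part from
|u| ≤ l, harmonic far part from the energy; then local energy inequality + Serrin). With the energy
bound it makes slow-class production OFF the (ν/l)-collar a priori integrable — the reduction of
crux 2 to its collar. [difficulty: L] -/
@[route_item "route-NavierStokesRegularity-HodographBetchov"]
def DeepSlowGradient : Prop :=
  ∀ (ν l A : ℝ), 0 < ν → 0 < l → 0 < A → ∃ C : ℝ, ∀ (T : ℝ) (u : ℝ → EuclideanSpace ℝ (Fin 3) → EuclideanSpace ℝ (Fin 3)) (p : ℝ → EuclideanSpace ℝ (Fin 3) → ℝ), Literature.Analysis.FluidPDE.IsClassicalNSSolutionOn (Set.Ico 0 T) ν 0 u p → Literature.Analysis.FluidPDE.IsLerayHopfOn T ν 0 (u 0) u → Literature.Analysis.FluidPDE.HasRapidSpatialDecay (u 0) → (∫⁻ x, ‖u 0 x‖ₑ ^ 2 ≤ ENNReal.ofReal A) → ∀ t₀ ∈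 Set.Ico 0 T, ν / l ^ 2 ≤ t₀ → ∀ x₀ : EuclideanSpace ℝ (Fin 3), (∀ t ∈ Set.Icc (t₀ - ν / l ^ 2) t₀, ∀ x ∈ Metric.closedBall x₀ (ν / l), ‖u t x‖ ≤ l) → ‖fderiv ℝ (u t₀) x₀‖ ≤ C

-- `DeepSlowGradient` holds: proved by `Summit.NavierStokesRegularity.NavierStokesRegularity.Theorems.deepSlowGradient_proof` @ 45b98f1133a7 (its module imports this route file, so no `_holds` link can be stated here).

/-- item stmt-NavierStokesRegularity-15837 · support · rank 9 · open · by planner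
sources: Miller2019, Constantin1990, Hou2022PotentiallySingularNS
[support] UNIFORM SLOW-CLASS BOUND (the quantitative, kit-falsifiable form of crux 2; not in
`closes`): for ν, T, A, l > 0 there is C = C(ν,T,A,l) bounding the slow-class production on [0,t], t
< T, of EVERY classical Leray–Hopf solution from a rapidly decaying datum with ∫|u₀|² ≤ A and
∫|∇u₀|² ≤ A. A bounded-data family whose slow collars pump production without bound before a fixed T
kills it while the per-solution crux 2 may survive. [difficulty: open-problem] -/
@[route_item "route-NavierStokesRegularity-HodographBetchov"]
def SlowClassProductionUniform : Prop :=
  ∀ (ν T A l : ℝ), 0 < ν → 0 < T → 0 < A → 0 < l → ∃ C : ℝ, ∀ (u : ℝ → EuclideanSpace ℝ (Fin 3) → EuclideanSpace ℝ (Fin 3)) (p : ℝ → EuclideanSpace ℝ (Fin 3) → ℝ), Literature.Analysis.FluidPDE.IsClassicalNSSolutionOn (Set.Ico 0 T) ν 0 u p → Literature.Analysis.FluidPDE.IsLerayHopfOn T ν 0 (u 0) u → Literature.Analysis.FluidPDE.HasRapidSpatialDecay (u 0) → (∫⁻ x, ‖u 0 x‖ₑ ^ 2 ≤ ENNReal.ofReal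 A) → (∫⁻ x, ‖fderiv ℝ (u 0) x‖ₑ ^ 2 ≤ ENNReal.ofReal A) → ∀ t ∈ Set.Ico 0 T, MeasureTheory.IntegrableOn (fun z : ℝ × EuclideanSpace ℝ (Fin 3) => inner ℝ (Literature.Analysis.FluidPDE.curl (u z.1) z.2) (fderiv ℝ (u z.1) z.2 (Literature.Analysis.FluidPDE.curl (u z.1) z.2))) {z : ℝ × EuclideanSpace ℝ (Fin 3) | z.1 ∈ Set.Ioo 0 t ∧ ‖u z.1 z.2‖ ≤ l} ∧ ∫ z in {z : ℝ × EuclideanSpace ℝ (Fin 3) | z.1 ∈ Set.Ioo 0 t ∧ ‖u z.1 z.2‖ ≤ l}, inner ℝ (Literature.Analysis.FluidPDE.curl (u z.1) z.2) (fderiv ℝ (u z.1) z.2 (Literature.Analysis.FluidPDE.curl (u z.1) z.2)) ≤ C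

/-- item stmt-NavierStokesRegularity-15838 · support · rank 9 · open · by planner
sources: CKN1982, EvansGariepy2015, KNSS2009
[support] HODOGRAPH ε-REGULARITY (card K3, an independent variant, not load-bearing): there is ε₀ >
0 such that a classical Leray–Hopf solution from a rapidly decaying datum on [0,T) extends smoothly
past T provided at every x₀ the time-integrated velocity-space volume swept (with multiplicity) by
small parabolic cylinders under (x₀,T) is small at the critical rate: ∫_(T−r²/ν)^T ∫_(B_r(x₀))
|det∇u| ≤ ε₀ ν²/r for all small r (scale-invariant; vanishes for locally 2.5-D gradients, so
strictly stronger than CKN's r⁻¹∫∫|∇u|²). [difficulty: open-problem] -/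
@[route_item "route-NavierStokesRegularity-HodographBetchov"]
def HodographEpsilonRegularity : Prop :=
  ∃ ε₀ : ℝ, 0 < ε₀ ∧ ∀ (ν T : ℝ), 0 < ν → 0 < T → ∀ (u : ℝ → EuclideanSpace ℝ (Fin 3) → EuclideanSpace ℝ (Fin 3)) (p : ℝ → EuclideanSpace ℝ (Fin 3) → ℝ), Literature.Analysis.FluidPDE.IsClassicalNSSolutionOn (Set.Ico 0 T) ν 0 u p → Literature.Analysis.FluidPDE.IsLerayHopfOn T ν 0 (u 0) u → Literature.Analysis.FluidPDE.HasRapidSpatialDecay (u 0) → (∀ x₀ : EuclideanSpace ℝ (Fin 3), ∃ r₀ : ℝ, 0 < r₀ ∧ r₀ ^ 2 / ν < T ∧ ∀ r ∈ Set.Ioo 0 r₀, ∫⁻ t in Set.Ioo (T - r ^ 2 / ν) T, ∫⁻ x in Metric.ball x₀ r, ‖(fderiv ℝ (u t) x).det‖ₑ ≤ ENNReal.ofReal (ε₀ * ν ^ 2 / r)) → Literature.Analysis.FluidPDE.HasSmoothExtensionPast ν 0 u T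

/-- item stmt-NavierStokesRegularity-18129 · support · rank 9 · closed · proved by Summit.NavierStokesRegularity.NavierStokesRegularity.Theorems.FastClassSqueeze.Split.fastClassSqueezeOfSubs_proof @ d2741c84041c (prover) · by planner
sources: Miller2019, Summits/NavierStokesRegularity/NavierStokesRegularity/Cruxes/FastClassSqueeze/Split.lean
[support] GLUE OF THE BC2 SPLIT of the crux FastClassSqueeze (stmt-NavierStokesRegularity-15832)
into its two typed pieces X₁ = NoFastEnergyConcentration (stmt-18118: no energy quantum escapes to
infinite speed — energy uniformly integrable over speed classes up to T) and X₂ =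
FastGradientSerrinStarved (stmt-18120: in an energy-starved fast class the velocity gradient is
Miller–Serrin finite). PROVED, sorry-free, standard axioms, lean check rc0: crux workfile
Cruxes/FastClassSqueeze/Split.lean @ee1716f1d25c, theorem
Summit.NavierStokesRegularity.NavierStokesRegularity.Theorems.FastClassSqueeze.Split.fastClassSqueeze_of_subs
(pieces stated inline, definitionally the route decls) — a prover lands it verbatim as
Theorems/HodographBetchovFastClassSqueezeSplit.lean (planners cannot write Theorems; route edit
--split --glue-by is final-cycle-gated). The seam: feed X₁ into X₂ along the given flow (modus
ponens), take the majorant m(t,x) := ‖∇u(t,x)‖, nonnegative, which realises the crux's min–max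
clause at every point because the operator norm majorises the Rayleigh quotient of ∇u on every
2-plane (split_plane_form_le_opNorm: first two standard basis vectors, Cauchy–Schwarz, Pythagoras); -/
@[route_item "route-NavierStokesRegularity-HodographBetchov"]
def FastClassSqueezeOfSubs : Prop :=
  NoFastEnergyConcentration → FastGradientSerrinStarved → FastClassSqueeze

-- `FastClassSqueezeOfSubs` holds: proved by `Summit.NavierStokesRegularity.NavierStokesRegularity.Theorems.FastClassSqueeze.Split.fastClassSqueezeOfSubs_proof` @ d2741c84041c (its module imports this route file, so no `_holds` link can be stated here).

-- earlier Assembly (stmt-NavierStokesRegularity-15839, replaced 2026-08-16T21:16:40Z -> stmt-NavierStokesRegularity-16864): retired by None — SlowClassProduction → FastClassSqueeze → LocalisedMiller → NoBlowupToClay → NavierStokesRegularity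
/-- item stmt-NavierStokesRegularity-16864 · assembly · rank 1 · closed · proved by Summit.NavierStokesRegularity.NavierStokesRegularity.Theorems.hodographBetchov_assembly_proof @ b8f5d93b7531 (prover) · by planner
sources: Fefferman2000, Miller2019
[assembly] SlowClassProduction → FastClassSqueeze → ClassBudgetsRegularise → NavierStokesRegularity
— the crux-only chain, literally the type of the deciding theorem `closes` (rev 3): for each Clay
datum the bridge crux needs one speed level carrying both class budgets along every classical
Leray–Hopf solution from the datum; FastClassSqueeze supplies the level, SlowClassProduction holds
at every level. (Rev-1 chain went through the supports LocalisedMiller and NoBlowupToClay;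
LocalisedMiller is now the per-solution core of the bridge, NoBlowupToClay's local theory sits
inside the bridge in A-form.) -/
@[route_item "route-NavierStokesRegularity-HodographBetchov"]
def Assembly : Prop :=
  SlowClassProduction → FastClassSqueeze → ClassBudgetsRegularise → NavierStokesRegularity

-- `Assembly` holds: proved by `Summit.NavierStokesRegularity.NavierStokesRegularity.Theorems.hodographBetchov_assembly_proof` @ b8f5d93b7531 (its module imports this route file, so no `_holds` link can be stated here).

/-! D-0027 §2.1 — DECIDING THEOREM (planner-authored via `route open/edit --closes-file`; by planner-rrepair-NavierStokesRegularity-Hodogra-6660cf4a-0 2026-08-17T18:39:41Z):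
its hypotheses are this route's items and its conclusion the sub-problem Statement (glue_lint), and it elaborates with this file. -/

@[closes "route-NavierStokesRegularity-HodographBetchov"] theorem closes (h₁ : SlowClassProduction) (hX₁ : NoFastEnergyConcentration)
    (hX₂ : FastGradientSerrinStarved) (h₃ : ClassBudgetsRegularise) :
    NavierStokesRegularity := by
  -- Crux-only deciding theorem, rev 8 (route-repair 2026-08-17, unused-crux): the fast-class squeeze now
  -- enters through its two BC2 pieces X₁ = `NoFastEnergyConcentration` (stmt-18118) and
  -- X₂ = `FastGradientSerrinStarved` (stmt-18120). The route's glue item `FastClassSqueezeOfSubs`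
  -- (stmt-18129: X₁ → X₂ → FastClassSqueeze; PROVED in tree, Theorems/HodographBetchovFastClassSqueezeSplit.lean,
  -- which cannot be imported into its own route file) is re-proved INLINE: along a flow feed X₁ into X₂,
  -- take the majorant m := ‖∇u‖, which realises the min–max clause on the span of the first two standard
  -- basis vectors (Cauchy–Schwarz, operator norm, Pythagoras). Then, datum by datum, the bridge crux
  -- `ClassBudgetsRegularise` asks along every classical Leray–Hopf solution from the datum for ONE speed
  -- level carrying both class budgets: `FastClassSqueeze` picks the level, `SlowClassProduction` holds at
  -- every level. Pure logic + one kinematic inequality; no Theorems import, no support hypothesis.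
  have hplane : ∀ A : EuclideanSpace ℝ (Fin 3) →L[ℝ] EuclideanSpace ℝ (Fin 3),
      ∃ v w : EuclideanSpace ℝ (Fin 3), ‖v‖ = 1 ∧ ‖w‖ = 1 ∧ inner ℝ v w = 0 ∧
        ∀ α β : ℝ, inner ℝ (A (α • v + β • w)) (α • v + β • w) ≤ ‖A‖ * (α ^ 2 + β ^ 2) := by
    intro A
    have hv : ‖(EuclideanSpace.basisFun (Fin 3) ℝ) 0‖ = 1 :=
      (EuclideanSpace.basisFun (Fin 3) ℝ).orthonormal.1 0
    have hw : ‖(EuclideanSpace.basisFun (Fin 3) ℝ) 1‖ = 1 :=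
      (EuclideanSpace.basisFun (Fin 3) ℝ).orthonormal.1 1
    have hvw : inner ℝ ((EuclideanSpace.basisFun (Fin 3) ℝ) 0) ((EuclideanSpace.basisFun (Fin 3) ℝ) 1) = 0 :=
      (EuclideanSpace.basisFun (Fin 3) ℝ).orthonormal.2 (by decide)
    refine ⟨(EuclideanSpace.basisFun (Fin 3) ℝ) 0, (EuclideanSpace.basisFun (Fin 3) ℝ) 1, hv, hw, hvw, ?_⟩
    intro α β
    have hnorm : ‖α • (EuclideanSpace.basisFun (Fin 3) ℝ) 0 + β • (EuclideanSpace.basisFun (Fin 3) ℝ) 1‖ ^ 2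
        = α ^ 2 + β ^ 2 := by
      rw [norm_add_sq_real, real_inner_smul_left, real_inner_smul_right, hvw, norm_smul, norm_smul, hv, hw]
      simp [sq_abs]
    calc inner ℝ (A (α • (EuclideanSpace.basisFun (Fin 3) ℝ) 0 + β • (EuclideanSpace.basisFun (Fin 3) ℝ) 1))
            (α • (EuclideanSpace.basisFun (Fin 3) ℝ) 0 + β • (EuclideanSpace.basisFun (Fin 3) ℝ) 1)
          ≤ ‖A (α • (EuclideanSpace.basisFun (Fin 3) ℝ) 0 + β • (EuclideanSpace.basisFun (Fin 3) ℝ) 1)‖ *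
              ‖α • (EuclideanSpace.basisFun (Fin 3) ℝ) 0 + β • (EuclideanSpace.basisFun (Fin 3) ℝ) 1‖ :=
            real_inner_le_norm _ _
      _ ≤ (‖A‖ * ‖α • (EuclideanSpace.basisFun (Fin 3) ℝ) 0 + β • (EuclideanSpace.basisFun (Fin 3) ℝ) 1‖) *
              ‖α • (EuclideanSpace.basisFun (Fin 3) ℝ) 0 + β • (EuclideanSpace.basisFun (Fin 3) ℝ) 1‖ :=
            mul_le_mul_of_nonneg_right (A.le_opNorm _) (norm_nonneg _)
      _ = ‖A‖ * ‖α • (EuclideanSpace.basisFun (Fin 3) ℝ) 0 + β • (EuclideanSpace.basisFun (Fin 3) ℝ) 1‖ ^ 2 := by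
            ring
      _ = ‖A‖ * (α ^ 2 + β ^ 2) := by rw [hnorm]
  have hsubs : FastClassSqueezeOfSubs := by
    intro hE hG ν T hν hT u p hcl hLH hdec
    obtain ⟨l, hl, q, hq, hint⟩ := hG ν T hν hT u p hcl hLH hdec (hE ν T hν hT u p hcl hLH hdec)
    refine ⟨l, hl, q, hq, fun t x => ‖fderiv ℝ (u t) x‖, fun t x => norm_nonneg _, ?_, ?_⟩
    · intro t _ x _
      exact hplane (fderiv ℝ (u t) x)
    · simpa using hint
  have h₂ : FastClassSqueeze := hsubs hX₁ hX₂
  intro ν hν u₀ hs hd hdec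
  refine h₃ ν hν u₀ hs hd hdec ?_
  intro T hT u p hcl hLH h0
  have hdec0 : Literature.Analysis.FluidPDE.HasRapidSpatialDecay (u 0) := h0 ▸ hdec
  obtain ⟨l, hl, hF⟩ := h₂ ν T hν hT u p hcl hLH hdec0
  exact ⟨l, hl, h₁ ν T hν hT u p hcl hLH hdec0 l hl, hF⟩

end Summit.NavierStokesRegularity.NavierStokesRegularity.Theses.HodographBetchov
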